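import Summits.RiemannHypothesis.RiemannHypothesis.Theorems.PfPersistenceThetaOddAutocorr
import Summits.RiemannHypothesis.RiemannHypothesis.Theorems.PfPersistenceAutocorrSplitLaw
import HarnessLib

/-!
# PF-persistence cell — THE NEAR-LAG CEILING LADDER for the odd autocorrelation (G1.02, one-signed on `H`)

Framing (page 1): mechanism/rigidity campaign; no RH claims.  Every `theorem` below is PROVED (kernel-checked, RH-free,
weight-free); nothing here concerns `ζ`.

The tree's far-lag sign lemma (`PfPersistenceThetaOddAutocorr`, b5f69233d226): `A⁻_v(y) ≤ 0` for `L/2 ≤ y ≤ L` when the odd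
profile `f = θ⁻_v` is one-signed on `H = [0, L/2]`.  This file moves INWARD.  THE STRADDLE DECOMPOSITION (§2, every odd
profile, every lag): `A⁻_v(y) = S_v(y) + 2·B_v(y)`, `S_v(y) = ∫_{-y}^{0} f(x)f(x+y)dx`, `B_v(y) = ∫_0^{L/2-y} f(t)f(t+y)dt`
(antisymmetry folds `[-L/2, -y]` onto `[0, L/2-y]`).  One-signedness on `H` is used ONLY on the straddle piece: `S_v(y) ≤ 0` for
`0 ≤ y ≤ L/2` (floored: `≤ 2φN‖u‖²`).  The piece `B` obeys, for EVERY `v`, the chain (path-graph) AM–GM bounds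
`2B ≤ c_m‖v‖²` on `y ≥ L/(2m)`: `c_2 = 1/2` (`y ≥ L/4`), `c_3 = √2/2` (`y ≥ L/6`), `c_4 = (1+√5)/4` (`y ≥ L/8`) — `c_m = cos(π/(m+1))`
with chain weights `sin(jπ/(m+1))`, here in closed algebraic form (no trigonometry).

THE LADDER (§3): one-signed on `H` ⇒ `A⁻_v(y) ≤ c‖v‖²` with `c = 0` (`y ≥ L/2`, the tree), `1/2` (`y ≥ L/4`), `√2/2` (`y ≥ L/6`),
`(1+√5)/4` (`y ≥ L/8`), each up to `y ≤ L`; floored versions `+ 2φN`.  Since `log 2 ≥ a/4` whenever `a ≤ 4 log 2 ≈ 2.77`, every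
prime `p ≥ 2` reached by such a window (`L = 2a`, lag `log p`) sits on a typed rung.  Rungs `m ≥ 5` (`log p < a/4`) exist with
`c_m = cos(π/(m+1))` but are NOT typed here.  The law these ceilings drive is `PfPersistenceAutocorrSplitMid`.
-/

set_option linter.dupNamespace false

noncomputable section

namespace Summit.RiemannHypothesis.RiemannHypothesis.Theorems.PfPersistence

open Real intervalIntegral MeasureTheory Matrix BigOperators Finset

/-! ## §1 Elementary integral inequalities (any continuous `f`) -/

/-- PROVED (weighted AM–GM): `2ab ≤ r a² + s b²` whenever `0 ≤ r` and `r s = 1`. [folklore] -/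
theorem two_mul_le_weighted {r s : ℝ} (hr : 0 ≤ r) (hrs : r * s = 1) (a b : ℝ) :
    2 * a * b ≤ r * a ^ 2 + s * b ^ 2 := by
  have hr0 : 0 < r := by
    rcases lt_or_eq_of_le hr with h | h
    · exact h
    · exfalso; rw [← h, zero_mul] at hrs; exact zero_ne_one hrs
  have key : r * (r * a ^ 2 + s * b ^ 2 - 2 * a * b) = (r * a - b) ^ 2 := by
    have e : r * (r * a ^ 2 + s * b ^ 2 - 2 * a * b) = (r * a - b) ^ 2 + (r * s - 1) * b ^ 2 := by ring
    rw [e, hrs]; ring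
  have h2 : 0 ≤ r * (r * a ^ 2 + s * b ^ 2 - 2 * a * b) := by rw [key]; exact sq_nonneg _
  have h3 : 0 ≤ r * a ^ 2 + s * b ^ 2 - 2 * a * b := by
    by_contra h
    push Not at h
    have := mul_neg_of_pos_of_neg hr0 h
    linarith
  linarith

/-- PROVED (the chain step): `2∫_a^b f(t)f(t+y)dt ≤ r∫_a^b f² + s∫_{a+y}^{b+y} f²` for continuous `f`, `a ≤ b`, `0 ≤ r`,
`r s = 1`. [folklore] -/
theorem two_mul_integral_mul_shift_le {f : ℝ → ℝ} (hf : Continuous f) {a b : ℝ} (hab : a ≤ b) (y : ℝ)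
    {r s : ℝ} (hr : 0 ≤ r) (hrs : r * s = 1) :
    2 * ∫ t in a..b, f t * f (t + y) ≤ r * (∫ t in a..b, f t ^ 2) + s * (∫ t in (a + y)..(b + y), f t ^ 2) := by
  have h1 : ∫ t in a..b, 2 * (f t * f (t + y)) ≤ ∫ t in a..b, (r * f t ^ 2 + s * f (t + y) ^ 2) := by
    refine intervalIntegral.integral_mono_on hab ?_ ?_ fun t _ => ?_
    · exact Continuous.intervalIntegrable (by fun_prop) _ _
    · exact Continuous.intervalIntegrable (by fun_prop) _ _
    · have := two_mul_le_weighted hr hrs (f t) (f (t + y)); linarith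
  have h2 : ∫ t in a..b, (r * f t ^ 2 + s * f (t + y) ^ 2)
      = r * (∫ t in a..b, f t ^ 2) + s * (∫ t in a..b, f (t + y) ^ 2) := by
    rw [intervalIntegral.integral_add (Continuous.intervalIntegrable (by fun_prop) _ _)
      (Continuous.intervalIntegrable (by fun_prop) _ _), intervalIntegral.integral_const_mul,
      intervalIntegral.integral_const_mul]
  have h3 : ∫ t in a..b, f (t + y) ^ 2 = ∫ t in (a + y)..(b + y), f t ^ 2 :=
    intervalIntegral.integral_comp_add_right (fun t => f t ^ 2) y
  rw [intervalIntegral.integral_const_mul] at h1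
  rw [← h3, ← h2]
  exact h1

/-- PROVED: `∫_a^b f² ≤ ∫_c^d f²` for `c ≤ a ≤ b ≤ d` (continuous `f`). [folklore] -/
theorem integral_sq_mono_interval {f : ℝ → ℝ} (hf : Continuous f) {a b c d : ℝ} (hca : c ≤ a) (hab : a ≤ b)
    (hbd : b ≤ d) : ∫ t in a..b, f t ^ 2 ≤ ∫ t in c..d, f t ^ 2 :=
  intervalIntegral.integral_mono_interval hca hab hbd
    (Filter.Eventually.of_forall fun t => sq_nonneg (f t))
    (Continuous.intervalIntegrable (by fun_prop) _ _)

/-- PROVED (adjacent cells): `∫_a^b f² + ∫_b^c f² = ∫_a^c f²` (continuous `f`, any `a b c`). [folklore] -/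
theorem integral_sq_add_adjacent {f : ℝ → ℝ} (hf : Continuous f) (a b c : ℝ) :
    (∫ t in a..b, f t ^ 2) + ∫ t in b..c, f t ^ 2 = ∫ t in a..c, f t ^ 2 :=
  intervalIntegral.integral_add_adjacent_intervals (Continuous.intervalIntegrable (by fun_prop) _ _)
    (Continuous.intervalIntegrable (by fun_prop) _ _)

/-- PROVED (adjacent ranges of the shifted product `f·f(·+y)`). [folklore] -/
theorem integral_mul_shift_add_adjacent {f : ℝ → ℝ} (hf : Continuous f) (y a b c : ℝ) :
    (∫ t in a..b, f t * f (t + y)) + ∫ t in b..c, f t * f (t + y) = ∫ t in a..c, f t * f (t + y) :=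
  intervalIntegral.integral_add_adjacent_intervals (Continuous.intervalIntegrable (by fun_prop) _ _)
    (Continuous.intervalIntegrable (by fun_prop) _ _)

/-! ## §2 The odd autocorrelation = straddle piece + twice the half-window shifted correlation -/

/-- PROVED (antisymmetry folds the left range onto `H`): `∫_{-L/2}^{-y} θ⁻_v(x)θ⁻_v(x+y)dx = ∫_0^{L/2-y} θ⁻_v(t)θ⁻_v(t+y)dt`
(substitute `x = −y − t`). [folklore] -/
theorem oddAutocorr_reflect (L : ℝ) {N : ℕ} (v : Fin N → ℝ) (y : ℝ) :
    ∫ x in (-(L / 2))..(-y), profileOdd L v x * profileOdd L v (x + y)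
      = ∫ t in (0:ℝ)..(L / 2 - y), profileOdd L v t * profileOdd L v (t + y) := by
  have h : (∫ x in (-(L / 2))..(-y), profileOdd L v (-y - x) * profileOdd L v (-y - x + y))
      = ∫ t in (-y - -y)..(-y - -(L / 2)), profileOdd L v t * profileOdd L v (t + y) :=
    intervalIntegral.integral_comp_sub_left (fun t => profileOdd L v t * profileOdd L v (t + y)) (-y)
  have e1 : -y - -y = (0:ℝ) := by ring
  have e2 : -y - -(L / 2) = L / 2 - y := by ring
  rw [e1, e2] at h
  rw [← h]
  refine intervalIntegral.integral_congr fun x _ => ?_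
  show profileOdd L v x * profileOdd L v (x + y) = profileOdd L v (-y - x) * profileOdd L v (-y - x + y)
  rw [show -y - x + y = -x by ring, show -y - x = -(x + y) by ring, profileOdd_neg, profileOdd_neg]
  ring

/-- **PROVED — THE STRADDLE DECOMPOSITION** (every odd profile, every lag):
`A⁻_v(y) = ∫_{-y}^{0} θ⁻_vθ⁻_v(·+y) + 2·∫_0^{L/2-y} θ⁻_vθ⁻_v(·+y)`. [folklore] -/
theorem oddAutocorr_eq_straddle_add (L : ℝ) {N : ℕ} (v : Fin N → ℝ) (y : ℝ) :
    oddAutocorr L v y = (∫ x in (-y)..0, profileOdd L v x * profileOdd L v (x + y))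
      + 2 * ∫ t in (0:ℝ)..(L / 2 - y), profileOdd L v t * profileOdd L v (t + y) := by
  have hf : Continuous (profileOdd L v) := continuous_profileOdd L v
  unfold oddAutocorr
  rw [← integral_mul_shift_add_adjacent hf y (-(L / 2)) (-y) (L / 2 - y),
    ← integral_mul_shift_add_adjacent hf y (-y) 0 (L / 2 - y), oddAutocorr_reflect L v y]
  ring

/-- PROVED: the straddle piece is `≤ 0` for a profile one-signed on `H` (`0 ≤ y ≤ L/2`: on `[-y, 0]` both `−x` and `x + y`
lie in `[0, y] ⊆ H`, and `θ⁻_v(x)θ⁻_v(x+y) = −θ⁻_v(−x)θ⁻_v(x+y)`). [folklore] -/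
theorem straddle_nonpos_of_oneSignedOdd {L : ℝ} {N : ℕ} {v : Fin N → ℝ} (hv : OneSignedOdd L v) {y : ℝ}
    (hy0 : 0 ≤ y) (hy : y ≤ L / 2) :
    ∫ x in (-y)..0, profileOdd L v x * profileOdd L v (x + y) ≤ 0 := by
  have h : 0 ≤ ∫ x in (-y)..0, -(profileOdd L v x * profileOdd L v (x + y)) := by
    apply intervalIntegral.integral_nonneg (by linarith)
    intro x hx
    have hs : -x ∈ Set.Icc 0 (L / 2) := ⟨by linarith [hx.2], by linarith [hx.1]⟩
    have ht : x + y ∈ Set.Icc 0 (L / 2) := ⟨by linarith [hx.1], by linarith [hx.2]⟩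
    have hgx : profileOdd L v x = -profileOdd L v (-x) := by rw [profileOdd_neg]; ring
    rw [hgx, neg_mul, neg_neg]
    rcases hv with h | h
    · exact mul_nonneg (h _ hs) (h _ ht)
    · exact mul_nonneg_of_nonpos_of_nonpos (h _ hs) (h _ ht)
  rw [intervalIntegral.integral_neg] at h
  linarith

/-- PROVED (floored straddle bound): a `φ`-floor one-signed odd profile on `H` (`0 ≤ φ`, `0 < L`) has straddle piece
`≤ 2φN‖u‖²` for `0 ≤ y ≤ L/2` (pointwise `−θ⁻_u(−x)θ⁻_u(x+y) ≤ 2φ·(max_H|θ⁻_u|)²` over a range of length `y ≤ L/2`, and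
`(max_H|θ⁻_u|)²·L ≤ 2N‖u‖²`). [folklore] -/
theorem straddle_le_of_floorOneSignedOdd {L φ : ℝ} (hL : 0 < L) (hφ : 0 ≤ φ) {N : ℕ} {u : Fin N → ℝ}
    (h : FloorOneSignedOdd L φ u) {y : ℝ} (hy0 : 0 ≤ y) (hy : y ≤ L / 2) :
    ∫ x in (-y)..0, profileOdd L u x * profileOdd L u (x + y) ≤ 2 * φ * N * (u ⬝ᵥ u) := by
  set M := profileOddMax L u with hMdef
  have hM0 : 0 ≤ M := profileOddMax_nonneg L u
  have hm : 0 ≤ φ * M := mul_nonneg hφ hM0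
  have hpt : ∀ x ∈ Set.Icc (-y) (0:ℝ),
      profileOdd L u x * profileOdd L u (x + y) ≤ 2 * (φ * M) * M := by
    intro x hx
    have hs : -x ∈ Set.Icc 0 (L / 2) := ⟨by linarith [hx.2], by linarith [hx.1]⟩
    have ht : x + y ∈ Set.Icc 0 (L / 2) := ⟨by linarith [hx.1], by linarith [hx.2]⟩
    have hgx : profileOdd L u x = -profileOdd L u (-x) := by rw [profileOdd_neg]; ring
    have h1 := abs_profileOdd_le_profileOddMax L u hs
    have h2 := abs_profileOdd_le_profileOddMax L u ht
    have key : -(2 * (φ * M) * M) ≤ profileOdd L u (-x) * profileOdd L u (x + y) := by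
      rcases h with h | h
      · exact neg_le_mul_of_floor hm (h _ hs) (h _ ht) h1 h2
      · exact neg_le_mul_of_ceil hm (h _ hs) (h _ ht) h1 h2
    rw [hgx, neg_mul]
    linarith
  have hc : Continuous fun x => profileOdd L u x * profileOdd L u (x + y) :=
    (continuous_profileOdd L u).mul ((continuous_profileOdd L u).comp (continuous_id.add continuous_const))
  have hab : -y ≤ (0:ℝ) := by linarith
  have hi0 : IntervalIntegrable (fun _ : ℝ => 2 * (φ * M) * M) volume (-y) 0 := intervalIntegrable_const
  have hI := intervalIntegral.integral_mono_on hab (hc.intervalIntegrable _ _) hi0 hpt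
  rw [intervalIntegral.integral_const, smul_eq_mul] at hI
  have hMsq : M ^ 2 ≤ (u ⬝ᵥ u) * (N * (2 / L)) := profileOddMax_sq_le hL u
  have e : (u ⬝ᵥ u) * (N * (2 / L)) * L = (u ⬝ᵥ u) * (2 * N) := by field_simp
  have hMsq' : M ^ 2 * L ≤ (u ⬝ᵥ u) * (2 * N) := by
    have := mul_le_mul_of_nonneg_right hMsq hL.le
    rwa [e] at this
  have h2φ : 0 ≤ 2 * φ * M ^ 2 := mul_nonneg (mul_nonneg zero_le_two hφ) (sq_nonneg M)
  have k1 : (0 - -y) * (2 * φ * M ^ 2) ≤ (L / 2) * (2 * φ * M ^ 2) :=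
    mul_le_mul_of_nonneg_right (by linarith) h2φ
  have k2 : φ * (M ^ 2 * L) ≤ φ * ((u ⬝ᵥ u) * (2 * N)) := mul_le_mul_of_nonneg_left hMsq' hφ
  nlinarith [hI, k1, k2]

/-- PROVED (half-window Parseval): `∫_0^{L/2} (θ⁻_v)² = ‖v‖²/2` (`0 < L`; `(θ⁻_v)²` is even). [folklore] -/
theorem integral_profileOdd_sq_half {L : ℝ} (hL : 0 < L) {N : ℕ} (v : Fin N → ℝ) :
    ∫ x in (0:ℝ)..(L / 2), profileOdd L v x ^ 2 = 1 / 2 * (v ⬝ᵥ v) := by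
  have hf : Continuous (profileOdd L v) := continuous_profileOdd L v
  have hfull := integral_profileOdd_sq hL v
  have hsplit := integral_sq_add_adjacent hf (-(L / 2)) 0 (L / 2)
  have hneg : ∫ x in (-(L / 2))..0, profileOdd L v x ^ 2 = ∫ x in (0:ℝ)..(L / 2), profileOdd L v x ^ 2 := by
    have h1 : ∫ x in (-(L / 2))..0, profileOdd L v x ^ 2 = ∫ x in (-(L / 2))..0, profileOdd L v (-x) ^ 2 := by
      refine intervalIntegral.integral_congr fun x _ => ?_
      show profileOdd L v x ^ 2 = profileOdd L v (-x) ^ 2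
      rw [profileOdd_neg, neg_sq]
    have h2 : (∫ x in (-(L / 2))..0, profileOdd L v (-x) ^ 2) = ∫ x in (-0)..(-(-(L / 2))), profileOdd L v x ^ 2 :=
      intervalIntegral.integral_comp_neg (fun t => profileOdd L v t ^ 2)
    rw [h1, h2, neg_zero, neg_neg]
  linarith

/-- **PROVED — RUNG `m = 2` (`c_2 = 1/2`):** for EVERY `v`, `2∫_0^{L/2-y} θ⁻_vθ⁻_v(·+y) ≤ ‖v‖²/2` when `L/4 ≤ y ≤ L/2`
(`2ff(·+y) ≤ f² + f(·+y)²`, and `[0, L/2−y]`, `[y, L/2]` are disjoint in `H` because `L/2 − y ≤ y`). [folklore] -/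
theorem two_mul_shiftCorr_le_half {L : ℝ} (hL : 0 < L) {N : ℕ} (v : Fin N → ℝ) {y : ℝ} (hy : L / 4 ≤ y)
    (hy2 : y ≤ L / 2) :
    2 * ∫ t in (0:ℝ)..(L / 2 - y), profileOdd L v t * profileOdd L v (t + y) ≤ 1 / 2 * (v ⬝ᵥ v) := by
  have hf : Continuous (profileOdd L v) := continuous_profileOdd L v
  have h1 := two_mul_integral_mul_shift_le hf (by linarith : (0:ℝ) ≤ L / 2 - y) y (r := 1) (s := 1) zero_le_one
    (by norm_num)
  rw [zero_add, sub_add_cancel, one_mul, one_mul] at h1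
  have h2 : ∫ t in (0:ℝ)..(L / 2 - y), profileOdd L v t ^ 2 ≤ ∫ t in (0:ℝ)..y, profileOdd L v t ^ 2 :=
    integral_sq_mono_interval hf le_rfl (by linarith) (by linarith)
  have h3 := integral_sq_add_adjacent hf 0 y (L / 2)
  have h4 := integral_profileOdd_sq_half hL v
  linarith

/-- **PROVED — RUNG `m = 3` (`c_3 = √2/2`):** for EVERY `v`, `2∫_0^{L/2-y} θ⁻_vθ⁻_v(·+y) ≤ (√2/2)‖v‖²` when
`L/6 ≤ y ≤ L/4` (cells `[0,y] [y,2y] [2y,L/2]`, chain weights `√2, 1/√2`). [folklore] -/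
theorem two_mul_shiftCorr_le_sqrt_two {L : ℝ} (hL : 0 < L) {N : ℕ} (v : Fin N → ℝ) {y : ℝ} (hy : L / 6 ≤ y)
    (hy2 : y ≤ L / 4) :
    2 * ∫ t in (0:ℝ)..(L / 2 - y), profileOdd L v t * profileOdd L v (t + y)
      ≤ Real.sqrt 2 / 2 * (v ⬝ᵥ v) := by
  have hf : Continuous (profileOdd L v) := continuous_profileOdd L v
  set r := Real.sqrt 2 with hr
  have hr0 : 0 ≤ r := Real.sqrt_nonneg 2
  have hr2 : r ^ 2 = 2 := Real.sq_sqrt (by norm_num)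
  have hrs : r * (r / 2) = 1 := by nlinarith
  have hsr : r / 2 * r = 1 := by nlinarith
  have hy0 : 0 ≤ y := by linarith
  -- split B at y
  have hB := integral_mul_shift_add_adjacent hf y 0 y (L / 2 - y)
  -- piece 1 : [0, y] → [y, 2y]
  have p1 := two_mul_integral_mul_shift_le hf hy0 y hr0 hrs
  rw [zero_add, show y + y = 2 * y by ring] at p1
  -- piece 2 : [y, L/2 - y] → [2y, L/2]
  have p2 := two_mul_integral_mul_shift_le hf (by linarith : y ≤ L / 2 - y) y (by positivity : 0 ≤ r / 2) hsr
  rw [show y + y = 2 * y by ring, sub_add_cancel] at p2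
  have m2 : ∫ t in y..(L / 2 - y), profileOdd L v t ^ 2 ≤ ∫ t in y..(2 * y), profileOdd L v t ^ 2 :=
    integral_sq_mono_interval hf le_rfl (by linarith) (by linarith)
  have c1 := integral_sq_add_adjacent hf 0 y (L / 2)
  have c2 := integral_sq_add_adjacent hf y (2 * y) (L / 2)
  have hM := integral_profileOdd_sq_half hL v
  have k : r / 2 * ∫ t in y..(L / 2 - y), profileOdd L v t ^ 2 ≤ r / 2 * ∫ t in y..(2 * y), profileOdd L v t ^ 2 :=
    mul_le_mul_of_nonneg_left m2 (by positivity)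
  have e1 : r * (∫ t in (0:ℝ)..y, profileOdd L v t ^ 2) + r * (∫ t in y..(L / 2), profileOdd L v t ^ 2)
      = r * (1 / 2 * (v ⬝ᵥ v)) := by rw [← hM, ← c1]; ring
  have e2 : r * (∫ t in y..(2 * y), profileOdd L v t ^ 2) + r * (∫ t in (2 * y)..(L / 2), profileOdd L v t ^ 2)
      = r * (∫ t in y..(L / 2), profileOdd L v t ^ 2) := by rw [← c2]; ring
  linarith [hB, p1, p2, k, e1, e2]

/-- **PROVED — RUNG `m = 4` (`c_4 = (1+√5)/4 = cos(π/5)`):** for EVERY `v`, `2∫_0^{L/2-y} θ⁻_vθ⁻_v(·+y) ≤ ((1+√5)/4)‖v‖²`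
when `L/8 ≤ y ≤ L/6` (cells `[0,y] [y,2y] [2y,3y] [3y,L/2]`, chain weights `φ, 1, 1/φ`, `φ = (1+√5)/2`, `φ(φ−1) = 1`).
[folklore] -/
theorem two_mul_shiftCorr_le_golden {L : ℝ} (hL : 0 < L) {N : ℕ} (v : Fin N → ℝ) {y : ℝ} (hy : L / 8 ≤ y)
    (hy2 : y ≤ L / 6) :
    2 * ∫ t in (0:ℝ)..(L / 2 - y), profileOdd L v t * profileOdd L v (t + y)
      ≤ (1 + Real.sqrt 5) / 4 * (v ⬝ᵥ v) := by
  have hf : Continuous (profileOdd L v) := continuous_profileOdd L v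
  set s := Real.sqrt 5 with hs
  have hs0 : 0 ≤ s := Real.sqrt_nonneg 5
  have hs2 : s ^ 2 = 5 := Real.sq_sqrt (by norm_num)
  have hg0 : 0 ≤ (1 + s) / 2 := by positivity
  have hψ0 : 0 ≤ (s - 1) / 2 := by nlinarith
  have hrs : (1 + s) / 2 * ((s - 1) / 2) = 1 := by nlinarith
  have hsr : (s - 1) / 2 * ((1 + s) / 2) = 1 := by nlinarith
  have hy0 : 0 ≤ y := by linarith
  -- split B at y and 2y
  have hB1 := integral_mul_shift_add_adjacent hf y 0 y (L / 2 - y)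
  have hB2 := integral_mul_shift_add_adjacent hf y y (2 * y) (L / 2 - y)
  -- piece 1 : [0, y] → [y, 2y], weights (φ, φ − 1)
  have p1 := two_mul_integral_mul_shift_le hf hy0 y hg0 hrs
  rw [zero_add, show y + y = 2 * y by ring] at p1
  -- piece 2 : [y, 2y] → [2y, 3y], weights (1, 1)
  have p2 := two_mul_integral_mul_shift_le hf (by linarith : y ≤ 2 * y) y (r := 1) (s := 1) zero_le_one
    (by norm_num)
  rw [show y + y = 2 * y by ring, show 2 * y + y = 3 * y by ring, one_mul, one_mul] at p2
  -- piece 3 : [2y, L/2 - y] → [3y, L/2], weights (φ − 1, φ)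
  have p3 := two_mul_integral_mul_shift_le hf (by linarith : 2 * y ≤ L / 2 - y) y hψ0 hsr
  rw [show 2 * y + y = 3 * y by ring, sub_add_cancel] at p3
  have m3 : ∫ t in (2 * y)..(L / 2 - y), profileOdd L v t ^ 2 ≤ ∫ t in (2 * y)..(3 * y), profileOdd L v t ^ 2 :=
    integral_sq_mono_interval hf le_rfl (by linarith) (by linarith)
  have c1 := integral_sq_add_adjacent hf 0 y (L / 2)
  have c2 := integral_sq_add_adjacent hf y (2 * y) (L / 2)
  have c3 := integral_sq_add_adjacent hf (2 * y) (3 * y) (L / 2)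
  have hM := integral_profileOdd_sq_half hL v
  have k : (s - 1) / 2 * ∫ t in (2 * y)..(L / 2 - y), profileOdd L v t ^ 2
      ≤ (s - 1) / 2 * ∫ t in (2 * y)..(3 * y), profileOdd L v t ^ 2 := mul_le_mul_of_nonneg_left m3 hψ0
  have e1 : s * (∫ t in (0:ℝ)..y, profileOdd L v t ^ 2) + s * (∫ t in y..(L / 2), profileOdd L v t ^ 2)
      = s * (1 / 2 * (v ⬝ᵥ v)) := by rw [← hM, ← c1]; ring
  have e2 : s * (∫ t in y..(2 * y), profileOdd L v t ^ 2) + s * (∫ t in (2 * y)..(L / 2), profileOdd L v t ^ 2)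
      = s * (∫ t in y..(L / 2), profileOdd L v t ^ 2) := by rw [← c2]; ring
  have e3 : s * (∫ t in (2 * y)..(3 * y), profileOdd L v t ^ 2) + s * (∫ t in (3 * y)..(L / 2), profileOdd L v t ^ 2)
      = s * (∫ t in (2 * y)..(L / 2), profileOdd L v t ^ 2) := by rw [← c3]; ring
  linarith [hB1, hB2, p1, p2, p3, k, c1, c2, c3, hM, e1, e2, e3]

/-! ## §3 The near-lag ceiling ladder for profiles one-signed on `H` -/

/-- **PROVED — MID-LAG CEILING (`m = 2`):** `θ⁻_v` one-signed on `H`, `L/4 ≤ y ≤ L` ⇒ `A⁻_v(y) ≤ ‖v‖²/2`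
(`y ≤ L/2`: straddle `≤ 0` + rung 2; `y ≥ L/2`: the far lemma gives `≤ 0`). [folklore] -/
theorem oddAutocorr_le_half_of_oneSignedOdd {L : ℝ} (hL : 0 < L) {N : ℕ} {v : Fin N → ℝ} (hv : OneSignedOdd L v)
    {y : ℝ} (hy : L / 4 ≤ y) (hyL : y ≤ L) : oddAutocorr L v y ≤ 1 / 2 * (v ⬝ᵥ v) := by
  have hvv : 0 ≤ v ⬝ᵥ v := dotProduct_self_nonneg_real v
  by_cases hfar : L / 2 ≤ y
  · have := oddAutocorr_nonpos_of_oneSignedOdd_far hv hfar hyL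
    nlinarith
  · push Not at hfar
    rw [oddAutocorr_eq_straddle_add]
    have h1 := straddle_nonpos_of_oneSignedOdd hv (by linarith) hfar.le
    have h2 := two_mul_shiftCorr_le_half hL v hy hfar.le
    linarith

/-- **PROVED — FLOORED MID-LAG CEILING:** `φ`-floor one-signed on `H` (`0 ≤ φ`), `L/4 ≤ y ≤ L` ⇒
`A⁻_u(y) ≤ (1/2 + 2φN)‖u‖²`. [folklore] -/
theorem oddAutocorr_le_of_floorOneSignedOdd_mid {L φ : ℝ} (hL : 0 < L) (hφ : 0 ≤ φ) {N : ℕ} {u : Fin N → ℝ}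
    (h : FloorOneSignedOdd L φ u) {y : ℝ} (hy : L / 4 ≤ y) (hyL : y ≤ L) :
    oddAutocorr L u y ≤ (1 / 2 + 2 * φ * N) * (u ⬝ᵥ u) := by
  have huu : 0 ≤ u ⬝ᵥ u := dotProduct_self_nonneg_real u
  have hφN : 0 ≤ 2 * φ * N * (u ⬝ᵥ u) := by positivity
  by_cases hfar : L / 2 ≤ y
  · have := oddAutocorr_le_of_floorOneSignedOdd_far hL hφ h hfar hyL
    nlinarith
  · push Not at hfar
    rw [oddAutocorr_eq_straddle_add]
    have h1 := straddle_le_of_floorOneSignedOdd hL hφ h (by linarith) hfar.le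
    have h2 := two_mul_shiftCorr_le_half hL u hy hfar.le
    linarith

/-- **PROVED — CEILING `m = 3`:** `θ⁻_v` one-signed on `H`, `L/6 ≤ y ≤ L` ⇒ `A⁻_v(y) ≤ (√2/2)‖v‖²`. [folklore] -/
theorem oddAutocorr_le_sqrt_two_of_oneSignedOdd {L : ℝ} (hL : 0 < L) {N : ℕ} {v : Fin N → ℝ}
    (hv : OneSignedOdd L v) {y : ℝ} (hy : L / 6 ≤ y) (hyL : y ≤ L) :
    oddAutocorr L v y ≤ Real.sqrt 2 / 2 * (v ⬝ᵥ v) := by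
  have hvv : 0 ≤ v ⬝ᵥ v := dotProduct_self_nonneg_real v
  have hr2 : Real.sqrt 2 ^ 2 = 2 := Real.sq_sqrt (by norm_num)
  have hr0 : 0 ≤ Real.sqrt 2 := Real.sqrt_nonneg 2
  have hone : 1 ≤ Real.sqrt 2 := by nlinarith
  by_cases hmid : L / 4 ≤ y
  · have := oddAutocorr_le_half_of_oneSignedOdd hL hv hmid hyL
    nlinarith
  · push Not at hmid
    rw [oddAutocorr_eq_straddle_add]
    have h1 := straddle_nonpos_of_oneSignedOdd (y := y) hv (by linarith) (by linarith)
    have h2 := two_mul_shiftCorr_le_sqrt_two hL v hy hmid.le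
    linarith

/-- **PROVED — FLOORED CEILING `m = 3`:** `A⁻_u(y) ≤ (√2/2 + 2φN)‖u‖²` for `L/6 ≤ y ≤ L`. [folklore] -/
theorem oddAutocorr_le_of_floorOneSignedOdd_third {L φ : ℝ} (hL : 0 < L) (hφ : 0 ≤ φ) {N : ℕ} {u : Fin N → ℝ}
    (h : FloorOneSignedOdd L φ u) {y : ℝ} (hy : L / 6 ≤ y) (hyL : y ≤ L) :
    oddAutocorr L u y ≤ (Real.sqrt 2 / 2 + 2 * φ * N) * (u ⬝ᵥ u) := by
  have huu : 0 ≤ u ⬝ᵥ u := dotProduct_self_nonneg_real u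
  have hr2 : Real.sqrt 2 ^ 2 = 2 := Real.sq_sqrt (by norm_num)
  have hr0 : 0 ≤ Real.sqrt 2 := Real.sqrt_nonneg 2
  have hone : 1 ≤ Real.sqrt 2 := by nlinarith
  by_cases hmid : L / 4 ≤ y
  · have := oddAutocorr_le_of_floorOneSignedOdd_mid hL hφ h hmid hyL
    nlinarith
  · push Not at hmid
    rw [oddAutocorr_eq_straddle_add]
    have h1 := straddle_le_of_floorOneSignedOdd (y := y) hL hφ h (by linarith) (by linarith)
    have h2 := two_mul_shiftCorr_le_sqrt_two hL u hy hmid.le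
    linarith

/-- **PROVED — CEILING `m = 4`:** `θ⁻_v` one-signed on `H`, `L/8 ≤ y ≤ L` ⇒ `A⁻_v(y) ≤ ((1+√5)/4)‖v‖²`. [folklore] -/
theorem oddAutocorr_le_golden_of_oneSignedOdd {L : ℝ} (hL : 0 < L) {N : ℕ} {v : Fin N → ℝ}
    (hv : OneSignedOdd L v) {y : ℝ} (hy : L / 8 ≤ y) (hyL : y ≤ L) :
    oddAutocorr L v y ≤ (1 + Real.sqrt 5) / 4 * (v ⬝ᵥ v) := by
  have hvv : 0 ≤ v ⬝ᵥ v := dotProduct_self_nonneg_real v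
  have hr2 : Real.sqrt 2 ^ 2 = 2 := Real.sq_sqrt (by norm_num)
  have hr0 : 0 ≤ Real.sqrt 2 := Real.sqrt_nonneg 2
  have hs2 : Real.sqrt 5 ^ 2 = 5 := Real.sq_sqrt (by norm_num)
  have hs0 : 0 ≤ Real.sqrt 5 := Real.sqrt_nonneg 5
  have hra : Real.sqrt 2 ≤ 3 / 2 := by nlinarith
  have hsb : 2 ≤ Real.sqrt 5 := by nlinarith
  by_cases hthird : L / 6 ≤ y
  · have := oddAutocorr_le_sqrt_two_of_oneSignedOdd hL hv hthird hyL
    nlinarith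
  · push Not at hthird
    rw [oddAutocorr_eq_straddle_add]
    have h1 := straddle_nonpos_of_oneSignedOdd (y := y) hv (by linarith) (by linarith)
    have h2 := two_mul_shiftCorr_le_golden hL v hy hthird.le
    linarith

/-- **PROVED — FLOORED CEILING `m = 4`:** `A⁻_u(y) ≤ ((1+√5)/4 + 2φN)‖u‖²` for `L/8 ≤ y ≤ L`. [folklore] -/
theorem oddAutocorr_le_of_floorOneSignedOdd_quarter {L φ : ℝ} (hL : 0 < L) (hφ : 0 ≤ φ) {N : ℕ} {u : Fin N → ℝ}
    (h : FloorOneSignedOdd L φ u) {y : ℝ} (hy : L / 8 ≤ y) (hyL : y ≤ L) :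
    oddAutocorr L u y ≤ ((1 + Real.sqrt 5) / 4 + 2 * φ * N) * (u ⬝ᵥ u) := by
  have huu : 0 ≤ u ⬝ᵥ u := dotProduct_self_nonneg_real u
  have hr2 : Real.sqrt 2 ^ 2 = 2 := Real.sq_sqrt (by norm_num)
  have hr0 : 0 ≤ Real.sqrt 2 := Real.sqrt_nonneg 2
  have hs2 : Real.sqrt 5 ^ 2 = 5 := Real.sq_sqrt (by norm_num)
  have hs0 : 0 ≤ Real.sqrt 5 := Real.sqrt_nonneg 5
  have hra : Real.sqrt 2 ≤ 3 / 2 := by nlinarith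
  have hsb : 2 ≤ Real.sqrt 5 := by nlinarith
  by_cases hthird : L / 6 ≤ y
  · have := oddAutocorr_le_of_floorOneSignedOdd_third hL hφ h hthird hyL
    nlinarith
  · push Not at hthird
    rw [oddAutocorr_eq_straddle_add]
    have h1 := straddle_le_of_floorOneSignedOdd (y := y) hL hφ h (by linarith) (by linarith)
    have h2 := two_mul_shiftCorr_le_golden hL u hy hthird.le
    linarith

end Summit.RiemannHypothesis.RiemannHypothesis.Theorems.PfPersistence

end
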